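import Summits.ABC.IUTFork.Charitable.Thm311D2
import Summits.ABC.IUTFork.Cor312PinnedCountermodel
import Summits.ABC.IUTFork.Cor312PinnedLogShellOneRho
import Summits.ABC.IUTFork.Cor312PinnedQDatum
import Summits.ABC.IUTFork.Cor312PinnedFrameFlip
import HarnessLib

/-!
# [IUTchIII] Thm 3.11, charitable re-typing D2 — the COUNTERMODEL side (branch D, team D2, deliverable (b); rung LADDER-ABC:A2.D)

Proof-and-witness file of the abc-iut cell (seat abc-iut-D2-cx = team D2 adversary; director-abc MINT-2 2026-08-26T05:19:22Z,
table of record `ladder-directors/LADDER-ABC.md` §1c). TAKES NO SIDE on [IUTchIII] Cor. 3.12 or on any author (Mochizuki /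
Scholze–Stix / Joshi / Dupuy–Hilado); locates / conditionally verifies; typed ≠ proved; establishment = our kernel check.

INPUT: team D2's maximally-charitable re-typing `Thm311Charitable_2 S n qK := PartI S ∧ PartII S ∧ PartIII S n qK` of [IUTchIII]
Thm 3.11 (i)–(iii) (kurims `paper:url-4b091feeb646` pp. 153–159; typer abc-iut-D2-typ, `Charitable/Thm311D2.lean`, p428473), eleven
named clauses; the hull-level alternative `Thm311Charitable_2H` (Rmk. 3.11.1 (iv) (APT) reading); target `S := PilotKummerIndRelated`.

WHAT THIS FILE CHECKS (clause by clause, at the countermodel of record `Cor312Vol.PinnedWitness.pinned_countermodel`, p419720 —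
the pinned `p`-adic naive model `(toyIndex, naiveFull p, pinnedSetting p, orbitRegion p, qDatum p)`, any prime `p`):
 * TEN of the eleven clauses HOLD as is (§2): `I_a_IndInvariant`, `I_c_GlobalDegrees`, `I_PermSymmetric`, `II_a_PacketKummer`,
   `II_Ind3_UpperSemiCompat`, `II_b_SplittingKummer`, `II_c_NumberFieldKummer`, `III_ab_UnitPortionLink`, `III_c_Stabilized`,
   `III_d_NumberFieldLink` — together with the typed Thm 3.11 of record, the bridge hypotheses, `|log(q)| > 0`, the three pins and
   `¬ Statement` (honest volumes `−|log(Θ)| = (5/2)·(−|log(q)|) < −|log(q)|`): `countermodel_2_minus_square` (§4);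
 * the ONE remaining clause `III_c_KummerLinkSquare` (Thm 3.11 (iii) (c) final sentence read as a commutative square of Kummer DATA up
   to (Ind1), (Ind2), (Ind3)) FAILS there (§3: ⟨(Ind1)∪(Ind2)⟩ acts by signs and fixes the Θ-monoid's Kummer image `Ψ`, which is not the
   q-pilot's datum) — it is the MINIMAL CLOSING SUB-CONJUNCTION: by team D2-prv's (a) line it alone (with the side inputs
   `I_PermSymmetric`, `II_b_SplittingKummer`, both true here) yields `S`, pins idle; so NO countermodel to the full typing exists, and the
   full typing is refuted at the honest model (`not_charitable_2`);
 * r3 «other identifications» (§3): over the FULL packet-automorphism group the same square HOLDS at the model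
   (`square_fullGroup`: the valuation-changing `x ↦ q^{1−j²}·x` carries `Ψ` onto the q-datum) — the typing's choice of the SMALL group
   ⟨(Ind1)∪(Ind2)⟩ is exactly what makes the clause bite;
 * the hull-level alternative `Thm311Charitable_2H` HOLDS, with the three pins, at the log-shell-scaled variant `d = 3` of
   `Cor312PinnedLogShellOneRho` where `S` FAILS (§5: a countermodel to `Thm311Charitable_2H ∧ pins → S`; there the Corollary's inequality
   holds, as `statement_of_pilotKummerCompatHull` forces);
 * NON-VACUITY of the (a) line (§6): at the identified-copies variant `idSetting` (q-regions := the Θ-regions `B_{j²}`, q-datum := `Ψ`)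
   the WHOLE typing, the three pins, the bridge hypotheses and `|log(q)| > 0` hold together (and so do `S` and the inequality).
Interface level over `l⋇ = 2`, one bad place; NOT a model of initial Θ-data; no judgement on print. Clause table: HOME `plan/D2/CX-D2.md`.
[claim: Mochizuki2012, status: disputed]
-/

noncomputable section

open Set

namespace Summit.ABC.IUTFork.Charitable.D2

open Thm311 Cor312 Cor312Vol Cor312Vol.PinnedWitness Cor312Vol.NaiveWitness Cor312Vol.PinnedHonest Cor312.Checks
  Cor312.IdentifiedNonVacuity Literature.IUT.LogThetaLattice

section model
variable (p : ℕ)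

/-- The lattice situation of the naive model (all columns: one `MRData`, one `Column`). [folklore] -/
abbrev L : LatticeSituation toyIndex := (naiveFull p).toLatticeSituation

/-! ## 1. Sign-stability kit -/

-- (`frobΨ_eq` = the landed `NaiveWitness.naiveFull_frobΨ`, Cor312PinnedQDatum — reused by name.)

/-- A sign-acting family maps a set onto a ball iff the set is that ball. [folklore] -/
theorem image_eq_pBall_iff {Φ : signShells.PacketAut} (hΦ : ActsBySigns Φ) (j : toyIndex.Label) (vQ : toyIndex.VQ)
    (A : Set (signShells.Packet j vQ)) (k : ℤ) : Φ j vQ '' A = pBall p j vQ k ↔ A = pBall p j vQ k := by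
  constructor
  · intro h
    calc A = Φ j vQ ⁻¹' (Φ j vQ '' A) := (Set.preimage_image_eq A (Φ j vQ).injective).symm
      _ = Φ j vQ ⁻¹' (Φ j vQ '' pBall p j vQ k) := by rw [h, image_pBall_of_actsBySigns p hΦ]
      _ = pBall p j vQ k := Set.preimage_image_eq _ (Φ j vQ).injective
  · rintro rfl; exact image_pBall_of_actsBySigns p hΦ j vQ k

/-- (Ind1)/(Ind2) generators act by signs. [folklore] -/
theorem actsBySigns_of_mem_union {Φ : signShells.PacketAut} (hΦ : Φ ∈ signShells.Ind1Family ∪ signShells.Ind2Family) :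
    ActsBySigns Φ := actsBySigns_of_mem_closure (Subgroup.subset_closure hΦ)

/-! ## 2. The ten clauses that HOLD at the model of record (any prime `p`) -/

/-- (i) (a): admissibility and log-volume are (Ind1)/(Ind2)-invariant — signs fix every ball. [folklore] -/
theorem I_a_holds : I_a_IndInvariant (L p) := by
  intro n
  refine ⟨fun Φ hΦ j vQ A ⟨k, hk⟩ => ?_, fun Φ hΦ j vQ B => ?_⟩
  · subst hk
    show pVol p j vQ (Φ j vQ '' pBall p j vQ k) = pVol p j vQ (pBall p j vQ k)
    rw [image_pBall_of_actsBySigns p (actsBySigns_of_mem_union hΦ)]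
  · show (∃ k, B = pBall p j vQ k) ↔ ∃ k, Φ j vQ '' B = pBall p j vQ k
    simp only [image_eq_pBall_iff p (actsBySigns_of_mem_union hΦ)]

/-- (i) (c): global degrees `deg k = −k·log p` are the (one-place) sums of the log-volumes of the regions `B_k`. [folklore] -/
theorem I_c_holds [Fact p.Prime] : I_c_GlobalDegrees (L p) := by
  intro n j k
  refine ⟨fun vQ => ⟨k, rfl⟩, Set.toFinite _, ?_⟩
  rw [finsum_unique]
  exact (pVol_pBall p j.1 _ k).symm

/-- (i) final portion: all columns carry the same data, so every column lies in every orbit. [folklore] -/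
theorem I_perm_holds : I_PermSymmetric (L p) := fun _ _ => Relation.EqvGen.refl _

/-- (ii) (a): Frobenius-like admissibility / log-volume (transported by the sign twist) = the étale-like ones. [folklore] -/
theorem II_a_holds : II_a_PacketKummer (L p) := by
  intro n m j vQ A
  refine ⟨?_, ?_⟩
  · show (∃ k, twist m j vQ '' A = pBall p j vQ k) ↔ ∃ k, A = pBall p j vQ k
    simp only [image_eq_pBall_iff p (twist_actsBySigns m)]
  · rintro ⟨k, rfl⟩
    show pVol p j vQ (twist m j vQ '' pBall p j vQ k) = pVol p j vQ (pBall p j vQ k)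
    rw [image_pBall_of_actsBySigns p (twist_actsBySigns m)]

/-- (ii) (Ind3): the unit images `B_{k+1}` and the ball images `B_0` lie in the log-shell `B_0`. [folklore] -/
theorem II_Ind3_holds : II_Ind3_UpperSemiCompat (L p) :=
  ⟨fun _ _ k j vQ => pBall_mono p j vQ (by omega), fun _ _ _ _ _ => subset_rfl⟩

/-- (ii) (b): `KummerB` at every column. [folklore] -/
theorem II_b_holds : II_b_SplittingKummer (L p) := fun _ m v _ => image_Psi_of_actsBySigns p (twist_actsBySigns m) v

/-- (ii) (c): the number-field copies are the whole global packet on both sides. [folklore] -/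
theorem II_c_holds : II_c_NumberFieldKummer (L p) := fun _ m j =>
  Set.image_univ_of_surjective (signShells.globalAut (twist m) j.1).surjective

/-- (iii) (a)(b): the log-shells of consecutive columns agree (`Φ = 1`). [folklore] -/
theorem III_ab_holds : III_ab_UnitPortionLink (L p) := fun _ =>
  ⟨1, one_mem _, fun j vQ => (image_pBall_of_mem_closure p (one_mem _) j vQ 0).symm⟩

/-- (iii) (c) gloss: a theorem of the carriers (typer's `III_c_Stabilized_holds`). [folklore] -/
theorem III_c1_holds : III_c_Stabilized (L p) := III_c_Stabilized_holds (L p)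

/-- (iii) (d): the number-field copies of consecutive columns agree (`Φ = 1`). [folklore] -/
theorem III_d_holds : III_d_NumberFieldLink (L p) := fun _ =>
  ⟨1, one_mem _, fun j => (Set.image_univ_of_surjective (signShells.globalAut 1 j.1).surjective).symm⟩

/-- Parts (i), (ii) and the non-square part of (iii) HOLD at the model of record. [folklore] -/
theorem charitable_2_minus_square_holds [Fact p.Prime] :
    PartI (L p) ∧ PartII (L p) ∧ III_ab_UnitPortionLink (L p) ∧ III_c_Stabilized (L p) ∧ III_d_NumberFieldLink (L p) :=
  ⟨⟨I_a_holds p, I_c_holds p, I_perm_holds p⟩, ⟨II_a_holds p, II_Ind3_holds p, II_b_holds p, II_c_holds p⟩,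
    III_ab_holds p, III_c1_holds p, III_d_holds p⟩

/-! ## 3. The square FAILS at the model of record (every column `n`), hence so does the full typing; r3: it HOLDS over the full group -/

/-- **`¬ III_c_KummerLinkSquare`** at the honest model: an ⟨(Ind1)∪(Ind2)⟩-translate of a column's Θ Kummer image `Ψ` is `Ψ`
(signs), and `Ψ ∋ (q^{j²})_j` is not the q-pilot's datum `{(±q)_j}` (`q ≠ ±q⁴` at label 2). [folklore] -/
theorem not_square [Fact p.Prime] (n : ℤ) : ¬ III_c_KummerLinkSquare (L p) n (qDatum p) := by
  rintro ⟨Φ, hΦ, m, h⟩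
  have hq : qDatum p = fun v _ => Psi p v := by
    funext v hv
    rw [h v hv, naiveFull_frobΨ p (n - 1) m]
    exact image_Psi_of_actsBySigns p (actsBySigns_of_mem_closure hΦ) v
  exact not_isThetaType_qDatum p (hq ▸ isThetaType_Psi p)

/-- **The full charitable typing FAILS at the honest model** (only through the square). [folklore] -/
theorem not_charitable_2 [Fact p.Prime] (n : ℤ) : ¬ Thm311Charitable_2 (L p) n (qDatum p) := fun h =>
  not_square p n (charitable_2_square (L p) h).2.2

/-- The scaling factor `q^{1−j²}` at label `j`. [folklore] -/
def scaleFactor (j : toyIndex.Label) : ℚ := (p : ℚ) ^ ((1 : ℤ) - ((j : ℕ) : ℤ) ^ 2)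

/-- The scaling factor is nonzero. [folklore] -/
theorem scaleFactor_ne_zero [hp : Fact p.Prime] (j : toyIndex.Label) : scaleFactor p j ≠ 0 :=
  zpow_ne_zero _ (by exact_mod_cast hp.out.ne_zero)

/-- r3: the VALUATION-CHANGING packet automorphism `x ↦ q^{1−j²}·x` (outside ⟨(Ind1)∪(Ind2)⟩; changes log-volumes). [folklore] -/
def scaleAut [Fact p.Prime] : signShells.PacketAut := fun j vQ =>
  (line j vQ).trans ((LinearEquiv.smulOfNeZero ℚ ℚ (scaleFactor p j) (scaleFactor_ne_zero p j)).trans (line j vQ).symm)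

/-- `scaleAut` multiplies the line coordinate by the scaling factor. [folklore] -/
theorem line_scaleAut [Fact p.Prime] (j : toyIndex.Label) (vQ : toyIndex.VQ) (x : signShells.Packet j vQ) :
    line j vQ (scaleAut p j vQ x) = scaleFactor p j * line j vQ x := by
  simp only [scaleAut, LinearEquiv.trans_apply, LinearEquiv.apply_symm_apply]
  rfl

/-- `q^{1−j²} · q^{j²} = q`. [folklore] -/
theorem scaleFactor_mul_pow [hp : Fact p.Prime] (j : toyIndex.Label) :
    scaleFactor p j * (p : ℚ) ^ ((j : ℕ) ^ 2) = (p : ℚ) ^ (1 : ℕ) := by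
  have hp0 : (p : ℚ) ≠ 0 := by exact_mod_cast hp.out.ne_zero
  unfold scaleFactor
  rw [← zpow_natCast (p : ℚ) ((j : ℕ) ^ 2), ← zpow_add₀ hp0]
  norm_num

/-- `qDatum = scaleAut · Ψ`: the q-pilot's Kummer datum IS a translate of the Θ-monoid's Kummer image under `x ↦ q^{1−j²}·x`. [folklore] -/
theorem qDatum_eq_scaleAut_image_Psi [Fact p.Prime] (v : toyIndex.V) (hv : v ∈ toyIndex.Vbad) :
    qDatum p v hv = signShells.starAut (scaleAut p) v '' Psi p v := by
  ext g
  simp only [qDatum, kummerOfExp, expOf_qData, Psi, Set.mem_setOf_eq, Set.mem_image]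
  constructor
  · intro hg
    refine ⟨fun j => (scaleAut p j.1 (toyIndex.over v)).symm (g j), fun j => ?_, ?_⟩
    · have hx : line j.1 (toyIndex.over v) (g j) =
          scaleFactor p j.1 * line j.1 (toyIndex.over v) ((scaleAut p j.1 (toyIndex.over v)).symm (g j)) := by
        rw [← line_scaleAut, LinearEquiv.apply_symm_apply]
      have hc := scaleFactor_ne_zero p j.1
      have hk := scaleFactor_mul_pow p j.1
      rcases hg j with h | h
      · left
        rw [pow_one] at h
        have : scaleFactor p j.1 * line j.1 (toyIndex.over v) ((scaleAut p j.1 (toyIndex.over v)).symm (g j)) =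
            scaleFactor p j.1 * (p : ℚ) ^ ((j.1 : ℕ) ^ 2) := by rw [← hx, h, hk, pow_one]
        exact mul_left_cancel₀ hc this
      · right
        rw [pow_one] at h
        have : scaleFactor p j.1 * line j.1 (toyIndex.over v) ((scaleAut p j.1 (toyIndex.over v)).symm (g j)) =
            scaleFactor p j.1 * (-(p : ℚ) ^ ((j.1 : ℕ) ^ 2)) := by rw [← hx, h, mul_neg, hk, pow_one]
        exact mul_left_cancel₀ hc this
    · funext j
      exact (scaleAut p j.1 (toyIndex.over v)).apply_symm_apply (g j)
  · rintro ⟨f, hf, rfl⟩ j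
    have hj : (signShells.starAut (scaleAut p) v f) j = scaleAut p j.1 (toyIndex.over v) (f j) := rfl
    rw [hj, line_scaleAut, pow_one]
    rcases hf j with h | h
    · left; rw [h, scaleFactor_mul_pow, pow_one]
    · right; rw [h, mul_neg, scaleFactor_mul_pow, pow_one]

/-- **r3: over the FULL packet-automorphism group the square HOLDS at the model of record** (same sentence, larger indeterminacy
group: the countermodel absorbs it; the typing's ⟨(Ind1)∪(Ind2)⟩ is what makes `III_c_KummerLinkSquare` bite). [folklore] -/
theorem square_fullGroup [Fact p.Prime] (n m : ℤ) : ∃ Φ : signShells.PacketAut, ∀ (v : toyIndex.V) (hv : v ∈ toyIndex.Vbad),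
    qDatum p v hv = signShells.starAut Φ v '' ((naiveFull p).col (n - 1)).frobΨ m v hv :=
  ⟨scaleAut p, fun v hv => by rw [naiveFull_frobΨ p (n - 1) m]; exact qDatum_eq_scaleAut_image_Psi p v hv⟩

end model

/-! ## 4. The witness of record at `p = 2` and the packaged countermodel -/

/-- `2` is prime (instance for the witness of record at `p = 2`). [folklore] -/
instance factPrimeTwo : Fact (Nat.Prime 2) := ⟨Nat.prime_two⟩

/-- A witness tuple for branch D: index data, full situation, Cor. 3.12 setting, region operator, q-pilot Kummer datum. -/
structure Witness where
  /-- index data -/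
  T : ThetaIndex
  /-- the typed Thm 3.11 carriers (log-shells, columns, link) -/
  F : FullSituation T
  /-- the Cor. 3.12 setting -/
  P : Cor312.Setting F.toLatticeSituation.toSituation
  /-- the ONE region-reading operator of both pins -/
  ρ : (∀ v : T.V, v ∈ T.Vbad → Set (F.L.StarPacket v)) → ∀ (j : T.Label) (vQ : T.VQ), Set (F.L.Packet j vQ)
  /-- the q-pilot's Kummer datum at the bad places -/
  qK : ∀ v : T.V, v ∈ T.Vbad → Set (F.L.StarPacket v)

/-- **The D2 countermodel**: the pinned `2`-adic naive model of record. [folklore] -/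
def charitableCountermodel_2 : Witness := ⟨toyIndex, naiveFull 2, pinnedSetting 2, orbitRegion 2, qDatum 2⟩

/-- The ten non-square clauses of `Thm311Charitable_2` HOLD at the countermodel. [folklore] -/
theorem charitable_2_holds_minus_square :
    PartI charitableCountermodel_2.F.toLatticeSituation ∧ PartII charitableCountermodel_2.F.toLatticeSituation ∧
      III_ab_UnitPortionLink charitableCountermodel_2.F.toLatticeSituation ∧
      III_c_Stabilized charitableCountermodel_2.F.toLatticeSituation ∧
      III_d_NumberFieldLink charitableCountermodel_2.F.toLatticeSituation :=
  charitable_2_minus_square_holds 2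

/-- The square — the minimal closing sub-conjunction — FAILS at the countermodel. [folklore] -/
theorem square_fails : ¬ III_c_KummerLinkSquare charitableCountermodel_2.F.toLatticeSituation charitableCountermodel_2.P.n
    charitableCountermodel_2.qK := not_square 2 _

/-- **The typed Statement of Cor. 3.12 FAILS at the countermodel** (honest volumes: `−(5/2)·log 2 < −log 2`). [folklore] -/
theorem statement_fails : ¬ charitableCountermodel_2.P.Statement := pinnedSetting_not_statement 2

/-- **COUNTERMODEL (b), team D2**: index data, a full situation, a setting, ONE operator and a q-datum with — the typed Thm 3.11 of
record ∧ bridge hypotheses ∧ `|log(q)| > 0` ∧ the three pins ∧ Parts (i), (ii) and clauses (iii)(a)(b), (c)-gloss, (d) of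
`Thm311Charitable_2` — and yet `¬ III_c_KummerLinkSquare`, `¬ S`, `¬ Statement`, with `−|log(Θ)| = (5/2)·(−|log(q)|)`. So the closing
sub-conjunction of the charitable typing is exactly `{III_c_KummerLinkSquare}`. [folklore] -/
theorem countermodel_2_minus_square :
    ∃ (T : ThetaIndex) (F : FullSituation T) (P : Cor312.Setting F.toLatticeSituation.toSituation)
      (ρ : (∀ v : T.V, v ∈ T.Vbad → Set (F.L.StarPacket v)) → ∀ (j : T.Label) (vQ : T.VQ), Set (F.L.Packet j vQ))
      (qK : ∀ v : T.V, v ∈ T.Vbad → Set (F.L.StarPacket v)),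
      F.Statement ∧ BridgeHyps P ∧ P.AbsLogQPos ∧ PinnedRegions3 F.toLatticeSituation P ρ qK ∧
      (PartI F.toLatticeSituation ∧ PartII F.toLatticeSituation ∧ III_ab_UnitPortionLink F.toLatticeSituation ∧
        III_c_Stabilized F.toLatticeSituation ∧ III_d_NumberFieldLink F.toLatticeSituation) ∧
      ¬ III_c_KummerLinkSquare F.toLatticeSituation P.n qK ∧ ¬ Thm311Charitable_2 F.toLatticeSituation P.n qK ∧
      ¬ PilotKummerIndRelated F.toLatticeSituation P ρ qK ∧ ¬ P.Statement ∧
      P.negLogTheta = (((5 : ℝ) / 2 * P.negLogQ : ℝ) : WithTop ℝ) :=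
  ⟨toyIndex, naiveFull 2, pinnedSetting 2, orbitRegion 2, qDatum 2, naiveFull_statement 2, pinnedSetting_bridgeHyps 2,
    pinnedSetting_absLogQPos 2, pinnedSetting_pinnedRegions3 2, charitable_2_minus_square_holds 2, not_square 2 _,
    not_charitable_2 2 _, pinnedSetting_not_pilotKummerIndRelated 2, pinnedSetting_not_statement 2,
    pinnedSetting_negLogTheta_eq_mul_negLogQ 2⟩

/-! ## 5. The hull-level alternative `Thm311Charitable_2H` does NOT give `S`: it holds, with the pins, at the `d = 3` log-shell model -/

section hull
variable (p : ℕ) [hp : Fact p.Prime]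

/-- At `shellSetting p 3` (Θ-regions `B_{j²−3}`) read by the one operator `rhoOne p 3`, the hull clause holds: `B_1 ⊆ B_{j²−3}`,
`𝒪 ⊆ B_{−3}`. [folklore] -/
theorem hullClause_shell3 : PilotKummerCompatHull (L p) (shellSetting p 3) (rhoOne p 3) (qDatum p) := by
  intro j vQ
  rw [← oneRho_qPinned p 3 j vQ, shell_qRegion_eq p 3, (shell_thetaHull p 3 j vQ).1]
  by_cases hj : j = 0
  · subst hj; rw [pinnedSetting_qRegion_zero]; exact pBall_mono p _ vQ (by simp [jsq])
  · rw [pinnedSetting_qRegion_of_ne_zero p hj]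
    have h2 : ((j : ℕ) : ℤ) ≤ 2 := by have h := j.isLt; change (j : ℕ) < 2 + 1 at h; omega
    have h0 : (0 : ℤ) ≤ ((j : ℕ) : ℤ) := by positivity
    have h4 : ((j : ℕ) : ℤ) ^ 2 ≤ 4 := by nlinarith
    exact pBall_mono p j vQ (by unfold jsq; push_cast; omega)

/-- **`Thm311Charitable_2H` HOLDS at the `d = 3` log-shell model with the three pins, the bridge hypotheses, `|log(q)| > 0` — and
`¬ S`** (there the Corollary's inequality is TRUE: a hull-level reading yields `Statement`, never `S`). [folklore] -/
theorem hull_variant_no_S :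
    Thm311Charitable_2H (L p) (shellSetting p 3) (rhoOne p 3) (qDatum p) ∧ BridgeHyps (shellSetting p 3) ∧
      (shellSetting p 3).AbsLogQPos ∧ PinnedRegions3 (L p) (shellSetting p 3) (rhoOne p 3) (qDatum p) ∧
      ¬ PilotKummerIndRelated (L p) (shellSetting p 3) (rhoOne p 3) (qDatum p) ∧ (shellSetting p 3).Statement := by
  have hfam := oneRho_family p 3
  refine ⟨⟨(charitable_2_minus_square_holds p).1, (charitable_2_minus_square_holds p).2.1,
    (charitable_2_minus_square_holds p).2.2, hullClause_shell3 p⟩, hfam.1.2.1, hfam.1.2.2.1, hfam.1.2.2.2.1, fun hS => ?_,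
    hfam.2.2.2 (by norm_num)⟩
  exact hfam.1.2.2.2.2 ((gapA3_iff (L p) (shellSetting p 3) (rhoOne p 3) (qDatum p)
    (kummerB_of_II_b (L p) (II_b_holds p) _)).2 fun _ => hS)

end hull

/-! ## 6. NON-VACUITY of the (a) line: the WHOLE typing + three pins + bridge hypotheses + `|log(q)| > 0` hold together -/

section nonvacuity
variable (p : ℕ) [hp : Fact p.Prime]

/-- **`idSetting`** — the identified-copies variant of the pinned setting: the q-side glue reads the q-pilot's object `k` as the
regions `B_{k·j²}` (so, for the setting's own q-pilot `k = 1`, the Θ-regions `B_{j²}` themselves); everything else as in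
`pinnedSetting`. With q-datum `Ψ` (the Θ-monoid's own Kummer image) this is a model of the WHOLE charitable typing (the square with
`Φ = 1`), the pins, the bridge hypotheses and `|log(q)| > 0` — NOT honest for print's q-pilot (valuation `1`, not `j²`); it only
certifies that team D2's (a) implication is not vacuously true. [claim: Mochizuki2012, status: disputed] -/
@[claim "Mochizuki2012" "disputed"]
def idSetting : Cor312.Setting (naiveSituation p) :=
  { pinnedSetting p with
    qRegionOf := fun (k : ℤ) (j : toyIndex.Label) (vQ : toyIndex.VQ) => pBall p j vQ (k * jsq j)
    qRegion_mem := fun _ _ => ⟨_, rfl⟩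
    qSupport_finite := fun _ => Set.toFinite _ }

/-- The Θ-monoid's Kummer image as the q-datum (identified copies). [folklore] -/
def thetaDatum : ∀ v : toyIndex.V, v ∈ toyIndex.Vbad → Set (signShells.StarPacket v) := fun v _ => Psi p v

omit hp in
/-- `idSetting`'s q-region is `B_{j²}`. [folklore] -/
theorem idSetting_qRegion (j : toyIndex.Label) (vQ : toyIndex.VQ) : (idSetting p).qRegion j vQ = pBall p j vQ (jsq j) := by
  show pBall p j vQ (((expOf gen : ℕ) : ℤ) * jsq j) = _
  rw [expOf_gen]; simp

/-- The operator evaluated on `Ψ` gives `B_{j²}` (the Θ-pin of the model of record, read backwards). [folklore] -/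
theorem orbitRegion_thetaDatum (j : toyIndex.Label) (vQ : toyIndex.VQ) : orbitRegion p (thetaDatum p) j vQ = pBall p j vQ (jsq j) := by
  have h := (pinnedSetting_thetaPinned p).2 0 j vQ
  rw [naiveFull_frobΨ p _ 0, pinnedSetting_thetaRegion] at h
  exact h.symm

/-- The three pins hold at `(idSetting, orbitRegion, Ψ)`. [folklore] -/
theorem idSetting_pinnedRegions3 : PinnedRegions3 (L p) (idSetting p) (orbitRegion p) (thetaDatum p) :=
  ⟨⟨⟨fun Φ hΦ Ψ j vQ => orbitRegion_equivariant p hΦ Ψ j vQ, fun m j vQ => (pinnedSetting_thetaPinned p).2 m j vQ⟩,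
    fun j vQ => by rw [idSetting_qRegion, orbitRegion_thetaDatum]⟩, pinnedSetting_pilotLink p⟩

/-- The bridge hypotheses hold at `idSetting` (they concern the Θ-side and the frame, unchanged). [folklore] -/
theorem idSetting_bridgeHyps : BridgeHyps (idSetting p) :=
  have h := pinnedSetting_bridgeHyps p
  ⟨h.mono, h.image_adm, h.image_fin, h.hul_nonempty, h.theta_nonempty, h.finite⟩

-- (`one_le_jsq_labelSucc` = the landed `PinnedHonest.one_le_jsq`, Cor312PinnedFrameFlip — reused by name.)

/-- `|log(q)| > 0` at `idSetting`: every q-local volume `−j²·log p` is negative. [folklore] -/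
theorem idSetting_absLogQPos : (idSetting p).AbsLogQPos := by
  show processionNormalized (fun i => ∑ᶠ vQ : toyIndex.VQ, (idSetting p).qLocal (Setting.labelSucc i) vQ) < 0
  unfold processionNormalized
  refine div_neg_of_neg_of_pos (Finset.sum_neg (fun i _ => ?_) ⟨⟨0, lt_of_lt_of_le two_pos toyIndex.two_le_lstar⟩,
    Finset.mem_univ _⟩) (Nat.cast_pos.2 (lt_of_lt_of_le two_pos toyIndex.two_le_lstar))
  rw [finsum_unique]
  show pVol p _ _ ((idSetting p).qRegion (Setting.labelSucc i) _) < 0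
  rw [idSetting_qRegion, pVol_pBall]
  have h1 : (1 : ℝ) ≤ (jsq (Setting.labelSucc i) : ℝ) := by exact_mod_cast one_le_jsq i
  nlinarith [log_p_pos p]

/-- The square holds at `(idSetting, Ψ)` with `Φ = 1` (every column, every row). [folklore] -/
theorem idSetting_square (n : ℤ) : III_c_KummerLinkSquare (L p) n (thetaDatum p) :=
  ⟨1, one_mem _, 0, fun v _ => by
    rw [naiveFull_frobΨ p _ 0]
    exact (image_Psi_of_actsBySigns p (actsBySigns_of_mem_closure (one_mem _)) v).symm⟩

/-- **NON-VACUITY**: the typed Thm 3.11 of record, the WHOLE charitable typing `Thm311Charitable_2`, the three pins, the bridge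
hypotheses and `|log(q)| > 0` hold TOGETHER at `(toyIndex, naiveFull p, idSetting p, orbitRegion p, Ψ)` — where, accordingly, `S` and
the typed Statement hold. [folklore] -/
theorem charitable_2_nonvacuous :
    (naiveFull p).Statement ∧ Thm311Charitable_2 (L p) (idSetting p).n (thetaDatum p) ∧
      PinnedRegions3 (L p) (idSetting p) (orbitRegion p) (thetaDatum p) ∧ BridgeHyps (idSetting p) ∧ (idSetting p).AbsLogQPos ∧
      PilotKummerIndRelated (L p) (idSetting p) (orbitRegion p) (thetaDatum p) ∧ (idSetting p).Statement := by
  have hc := charitable_2_minus_square_holds p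
  have hKumB : ((L p).col (idSetting p).n).KummerB ((L p).D (idSetting p).n) := kummerB_of_II_b (L p) (II_b_holds p) _
  have hS : PilotKummerIndRelated (L p) (idSetting p) (orbitRegion p) (thetaDatum p) :=
    pilotKummerIndRelated_of_pilotKummerCompat (L p) (idSetting p) (orbitRegion p) (thetaDatum p) hKumB
      ⟨1, one_mem _, 0, fun v _ => by
        rw [naiveFull_frobΨ p _ 0]
        exact (image_Psi_of_actsBySigns p (actsBySigns_of_mem_closure (one_mem _)) v).symm⟩
  exact ⟨naiveFull_statement p, ⟨hc.1, hc.2.1, hc.2.2.1, hc.2.2.2.1, idSetting_square p _, hc.2.2.2.2⟩,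
    idSetting_pinnedRegions3 p, idSetting_bridgeHyps p, idSetting_absLogQPos p, hS,
    statement_of_pinned3_of_pilotKummerIndRelated (L p) (idSetting p) (orbitRegion p) (thetaDatum p) (idSetting_bridgeHyps p)
      hKumB (idSetting_pinnedRegions3 p) hS⟩

end nonvacuity

end Summit.ABC.IUTFork.Charitable.D2

end
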